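import Mathlib.Analysis.SpecialFunctions.Trigonometric.ArctanDeriv
import Literature.Geometry.Lorentzian.Genericity
import Literature.Geometry.Lorentzian.FinalState

/-!
# drefute evidence: stub 1 `stub_localEscapeSuffices` of line `one-locked-explosion` is TRUE

Candidate proof (refuter-attached evidence for the lead; a prover lands it). The statement and
`HasLocalEscape` are copied VERBATIM from
`Cruxes/StationaryLimitReduction/Lines/one-locked-explosion.lean` (§0, §1a), in a scratch
namespace because the skeleton module is not importable. Proof = the reparametrisation of the
docstring with the contraction `θ(c) = (ε/π) · arctan` applied to the single coordinate of `ℝ¹`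
(smooth, injective, `θ 0 = 0`, `0 < ‖θ c‖ < ε` for `c ≠ 0`).
-/

noncomputable section

open scoped Manifold ContDiff Topology
open Set Literature.Geometry.Lorentzian

namespace DrefuteOneLockedExplosion

variable {X : Type} [TopologicalSpace X] [ChartedSpace E3 X] [IsManifold (𝓡 3) ∞ X]

/-- VERBATIM copy of the skeleton's `HasLocalEscape`. -/
def HasLocalEscape (𝓓 : Set (InitialDataSet (𝓡 3) X)) (P : InitialDataSet (𝓡 3) X → Prop)
    (d : InitialDataSet (𝓡 3) X) : Prop :=
  ∃ F : EuclideanSpace ℝ (Fin 1) → InitialDataSet (𝓡 3) X,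
    InitialDataSet.IsSmoothDataFamily 1 F ∧ F 0 = d ∧ Function.Injective F ∧ (∀ c, F c ∈ 𝓓) ∧
      ∃ ε : ℝ, 0 < ε ∧ ∀ c, c ≠ 0 → ‖c‖ < ε → P (F c)

/-- The contraction of `ℝ¹` used to reparametrise a local escape: `θ_δ(c) = (δ · arctan cᵢ)ᵢ`. -/
def contract (δ : ℝ) (c : EuclideanSpace ℝ (Fin 1)) : EuclideanSpace ℝ (Fin 1) :=
  WithLp.toLp 2 (fun i ↦ δ * Real.arctan (c i))

@[simp] theorem contract_apply (δ : ℝ) (c : EuclideanSpace ℝ (Fin 1)) (i : Fin 1) :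
    contract δ c i = δ * Real.arctan (c i) := rfl

theorem contract_zero (δ : ℝ) : contract δ 0 = 0 := by
  ext i; simp

theorem contDiff_contract (δ : ℝ) : ContDiff ℝ ∞ (contract δ) := by
  rw [contDiff_euclidean]
  intro i
  have hi : ContDiff ℝ ∞ (fun x : EuclideanSpace ℝ (Fin 1) ↦ x i) :=
    (EuclideanSpace.proj (𝕜 := ℝ) i).contDiff
  exact contDiff_const.mul (Real.contDiff_arctan.comp hi)

theorem contract_injective {δ : ℝ} (hδ : δ ≠ 0) : Function.Injective (contract δ) := by
  intro a b hab
  ext i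
  have h := congrArg (fun v : EuclideanSpace ℝ (Fin 1) ↦ v i) hab
  simp only [contract_apply] at h
  exact Real.arctan_strictMono.injective (mul_left_cancel₀ hδ h)

theorem contract_ne_zero {δ : ℝ} (hδ : δ ≠ 0) {c : EuclideanSpace ℝ (Fin 1)} (hc : c ≠ 0) :
    contract δ c ≠ 0 := by
  intro h
  apply hc
  rw [← contract_zero δ] at h
  exact contract_injective hδ h

theorem norm_contract_lt {δ ε : ℝ} (hδ : 0 ≤ δ) (hδε : δ * (Real.pi / 2) < ε)
    (c : EuclideanSpace ℝ (Fin 1)) : ‖contract δ c‖ < ε := by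
  rw [EuclideanSpace.norm_eq]
  simp only [Fin.sum_univ_one, Real.norm_eq_abs, sq_abs]
  rw [Real.sqrt_sq_eq_abs]
  show |δ * Real.arctan (c 0)| < ε
  rw [abs_mul, abs_of_nonneg hδ]
  refine lt_of_le_of_lt ?_ hδε
  refine mul_le_mul_of_nonneg_left ?_ hδ
  exact (abs_lt.2 ⟨Real.neg_pi_div_two_lt_arctan _, Real.arctan_lt_pi_div_two _⟩).le

/-- **Stub 1 of line `one-locked-explosion` (`LocalEscapeSuffices`), VERBATIM statement.** -/
theorem localEscapeSuffices :
    ∀ (X : Type) [TopologicalSpace X] [ChartedSpace E3 X] [IsManifold (𝓡 3) ∞ X]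
      (𝓓 : Set (InitialDataSet (𝓡 3) X)) (P : InitialDataSet (𝓡 3) X → Prop),
      (∀ d ∈ 𝓓, ¬ P d → HasLocalEscape 𝓓 P d) →
        InitialDataSet.IsChristodoulouGeneric 𝓓 P 1 := by
  intro X _ _ _ 𝓓 P h d hd
  obtain ⟨hd𝓓, hbad⟩ := hd
  obtain ⟨F, hF, h0, hinj, h𝓓, ε, hε, hgood⟩ := h d hd𝓓 hbad
  set δ : ℝ := ε / Real.pi with hδdef
  have hπ : 0 < Real.pi := Real.pi_pos
  have hδpos : 0 < δ := div_pos hε hπ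
  have hδε : δ * (Real.pi / 2) < ε := by
    rw [hδdef]
    have : ε / Real.pi * (Real.pi / 2) = ε / 2 := by field_simp
    rw [this]
    linarith
  have hθ : ContMDiff 𝓘(ℝ, EuclideanSpace ℝ (Fin 1)) 𝓘(ℝ, EuclideanSpace ℝ (Fin 1)) ∞
      (contract δ) := (contDiff_contract δ).contMDiff
  have hprod := hθ.prodMap (contMDiff_id (I := 𝓡 3) (M := X) (n := ∞))
  refine ⟨F ∘ contract δ, ⟨hF.1.comp hprod, hF.2.comp hprod⟩, ?_, ?_, fun c ↦ h𝓓 _, ?_⟩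
  · show F (contract δ 0) = d
    rw [contract_zero, h0]
  · exact hinj.comp (contract_injective hδpos.ne')
  · rintro c hc ⟨-, hPc⟩
    exact hPc (hgood _ (contract_ne_zero hδpos.ne' hc) (norm_contract_lt hδpos.le hδε c))

end DrefuteOneLockedExplosion
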